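/-
Copyright (c) 2026 the pub-hodgecm-mathlib formalisation cell (harness21).  Prover seat hodgecm-mathlib-K2E3-p28 (g0), HCML Track B «K2-LIT» (CLOSE-OUT DAY, strike line L4
`stub_StCharTS`), h413 = `stmt-HodgeConjecture-24833`, line `K2_E3_EllipticInputs`, unit U12 «Characters», PART «SC» leaf (SC-an)₂, (M5e)₂∕(M5h)₂ chain: the `Fin 2`
twin of ★ (M5a)+ `K2E3SplitTorusQuotientMeasure` §3 (K2E3-p20 (g4)) — dealer K2E3-plan (g4) D143, `K2/STATUS.md` 2026-09-04T15:02:09Z.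
-/
import Summits.HodgeConjecture.HodgeConjecture.Theorems.K2E3SplitTorusQuotientMeasure     -- ★ p856941 (K2E3-p20 (g4)): the `{N}`-GENERIC §1 (`locallyCompactSpace_torusU`, `secondCountableTopology_torusU`, `exists_isHaarMeasure_torusU`) and §2 `exists_smulInvariantMeasure_quotient_torusU` (`hunimod`-conditional), reused BY NAME; brings ★ [M2a] `K2E3SupercuspModelFrameAtPlace` (`secondCountableTopology_unitaryGroupOfForm_adicCompletion`, generic `{N}`)
import Summits.HodgeConjecture.HodgeConjecture.Theorems.K2E3SupercuspModelFrameAtPlaceTwo  -- ★ p861132 [M2a]₂ (K2E3-p31 (g0) D136): `isMulRightInvariant_of_isHaarMeasure_of_eq_over` (unimodularity of `U(σ_w, Φ₂)(L_w)`), `locallyCompactSpace_unitaryGroupOfForm_adicCompletion` (`Fin 2`); brings ★ `K2E3HC14EllU11Haar`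
import HarnessLib

/-!
# h413 ∕ Track B «K2-LIT», (SC-an)₂ leaf, (M5e)₂∕(M5h)₂ chain — brick (M5a)+₂: A NON-ZERO `U`-INVARIANT RADON MEASURE ON `U(σ_w, Φ₂)(L_w) ⧸ T` AT A NON-SPLIT PLACE
# (Deitmar–Echterhoff 2014, Thm 1.5.3; Folland 1995, Thm 2.49; Harish-Chandra 1970, Part VI §8 — `dx*` on `G∕A`; the rank-one twin of ★ `K2E3SplitTorusQuotientMeasure` §3)

Cell `pub/hodgecm-mathlib`, crux H413 = `stmt-HodgeConjecture-24833`, route of record `HCCMUnconditional`; chair K2-lead (g2), L4 LINE-LEAD ∕ dealer K2E3-plan (g4), architect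
K2E3-p25 (g3).  THEOREMS ONLY (no `def`, no `instance`, no `notation`, no named-fact hypothesis, no `sorry`); lane `--supports stmt-HodgeConjecture-24833 --as helper`, count-neutral.

WHAT.  ★ `K2E3SplitTorusQuotientMeasure` (K2E3-p20 (g4)) discharges the auxiliary-measure binders `hρ` ∕ `hμQ` of the split-torus bricks: its §1 (`T` locally compact, second
countable, carries a Haar measure) and §2 (`∃ μQ` on `U ⧸ T`, `U`-invariant, finite on compacta, `≠ 0`, GIVEN unimodularity `hunimod`) are stated for `J : Matrix (Fin N) (Fin N) R`,
ANY `N`, ANY `J` — they need NO twin and the (M5e)₂∕(M5h)₂ porters (K2E3-p29 (g0) D145 `…SplitBallPlaceTwo`, K2E3-p33 (g0)) keep citing them BY NAME.  Only §3, the PLACE form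
with `hunimod` discharged, is `Fin 3`-typed (frame `J = Φ₃`, ★ [M2a] `isMulRightInvariant_of_isHaarMeasure_of_eq_over`).  THIS FILE is its `Fin 2` twin:
**`exists_smulInvariantMeasure_quotient_torusU_place`** — for a CM extension `L ∕ L⁺`, a place `w ∣ v` of `L` fixed by complex conjugation (i.e. `v` non-split), `σ_w` the
induced involution of `L_w`, `J = Φ₂` over `L_w`, and the consumer's Borel structures on `U = U(σ_w, J)(L_w)` and on `U ⧸ T` (`T = torusU σ_w J` the diagonal torus):
`∃ μQ : Measure (↥U ⧸ T), SMulInvariantMeasure ↥U _ μQ ∧ IsFiniteMeasureOnCompacts μQ ∧ μQ ≠ 0`.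

PROOF = the template's §3 token for token with the rank-one inputs: `hunimod` := ★ [M2a]₂ `K2E3SupercuspModelFrameAtPlaceTwo.isMulRightInvariant_of_isHaarMeasure_of_eq_over`
(K2E3-p31 (g0); = ★ `K2E3HC14EllU11Haar.isMulRightInvariant_of_isHaarMeasure` at `K := L_w` — `U(σ, Φ₂)(K)` is unimodular, K2E5-p15); instances `SecondCountableTopology ↥U` :=
★ [M2a] `secondCountableTopology_unitaryGroupOfForm_adicCompletion` (generic `{N}`), `LocallyCompactSpace ↥U` := ★ [M2a]₂ `locallyCompactSpace_unitaryGroupOfForm_adicCompletion`;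
then the GENERIC §2 BY NAME.

HONEST LABEL.  HC_CM is proved only modulo the 7 printed citations (2 remaining named inputs: hLiu418 = `stmt-HodgeConjecture-24832`, h413 = `stmt-HodgeConjecture-24833`)
until rung 0 closes; count-neutral helper (measure-theoretic plumbing for the (M5e)₂∕(M5h)₂ assembly; nothing printed is asserted as a fact); (SC-an)₂ stays OPEN.

## References
* [DeitmarEchterhoff2014] A. Deitmar, S. Echterhoff, *Principles of Harmonic Analysis*, 2nd ed., Universitext (2014), Lemma 1.5.1, Thm. 1.5.3.
* [Folland1995] G. B. Folland, *A Course in Abstract Harmonic Analysis* (1995), §2.6 Thm. 2.49.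
* [HarishChandra1970] Harish-Chandra (notes by G. van Dijk), *Harmonic Analysis on Reductive p-adic Groups*, LNM 162 (1970), Part VI §8 p. 60 (`dx*` on `G∕A`).
* [Rogawski1990] J. D. Rogawski, *Automorphic Representations of Unitary Groups in Three Variables*, Ann. of Math. Stud. 123 (1990), §1.10 p. 9; §3.6 p. 31; §4.13 p. 70.
* [GetzHahn2024] J. R. Getz, H. Hahn, *An Introduction to Automorphic Representations*, GTM 300 (2024), Cor. 3.5.2 (reductive groups over local fields are unimodular).
-/

set_option autoImplicit false
set_option linter.dupNamespace false  -- the mandated namespace repeats the single-problem summit's segment (`HodgeConjecture.HodgeConjecture`)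

noncomputable section

open NumberField IsDedekindDomain MeasureTheory Measure Set
open scoped ENNReal NNReal Matrix MatrixGroups Valued
open Literature.MeasureTheory.Group
open Literature.NumberTheory.Automorphic Literature.NumberTheory.Automorphic.UnitaryGroup Literature.NumberTheory.Rogawski1990
open Summit.HodgeConjecture.HodgeConjecture.Cruxes.H413

namespace Summit.HodgeConjecture.HodgeConjecture.Cruxes.H413.K2E3SplitTorusQuotientMeasureTwo

variable (L : Type) [Field L] [NumberField L] [IsCMField L] {v : HeightOneSpectrum (𝓞 ↥(maximalRealSubfield L))}
  (w : PlacesOver L v) (hw : IsCMField.complexConj L • w.1 = w.1)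

/-! ## The invariant measure on `U(σ_w, Φ₂)(L_w) ⧸ T`, no structural hypothesis left -/

/-- **A NON-ZERO INVARIANT RADON MEASURE ON `U(σ_w, Φ₂)(L_w) ⧸ T`** (the `hμQ` binder at the place, rank one): the `{N}`-GENERIC ★
`K2E3SplitTorusQuotientMeasure.exists_smulInvariantMeasure_quotient_torusU` (Deitmar–Echterhoff Thm 1.5.3, unimodular case; `T` closed abelian) with `hunimod` := ★ [M2a]₂
`isMulRightInvariant_of_isHaarMeasure_of_eq_over` and the instances ★ [M2a] `secondCountableTopology_unitaryGroupOfForm_adicCompletion` (generic `{N}`) ∕ ★ [M2a]₂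
`locallyCompactSpace_unitaryGroupOfForm_adicCompletion`.  Together with ★
`K2E3SplitTorusOrbitalBoundPlaceTwo` (`hKB`) every structural binder of the rank-one split-torus bricks is a theorem at the place; the GENERIC §1 of the template
(`locallyCompactSpace_torusU`, `secondCountableTopology_torusU`, `exists_isHaarMeasure_torusU`) applies at `N = 2` as it stands.
[cite: DeitmarEchterhoff2014, Thm. 1.5.3] [cite: Folland1995, §2.6 Thm. 2.49] [cite: HarishChandra1970, Part VI §8 p. 60] [cite: Rogawski1990, §3.6 p. 31] -/
theorem exists_smulInvariantMeasure_quotient_torusU_place {J : Matrix (Fin 2) (Fin 2) (w.1.adicCompletion L)}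
    (hJ : J = (StdForm.antidiagonal 2).over (w.1.adicCompletion L))
    [MeasurableSpace ↥(unitaryGroupOfForm (galAdicCompletionMap (L := L) (IsCMField.complexConj L) hw) J)]
    [BorelSpace ↥(unitaryGroupOfForm (galAdicCompletionMap (L := L) (IsCMField.complexConj L) hw) J)]
    [MeasurableSpace (↥(unitaryGroupOfForm (galAdicCompletionMap (L := L) (IsCMField.complexConj L) hw) J) ⧸
      torusU (galAdicCompletionMap (L := L) (IsCMField.complexConj L) hw) J)]
    [BorelSpace (↥(unitaryGroupOfForm (galAdicCompletionMap (L := L) (IsCMField.complexConj L) hw) J) ⧸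
      torusU (galAdicCompletionMap (L := L) (IsCMField.complexConj L) hw) J)] :
    ∃ μQ : Measure (↥(unitaryGroupOfForm (galAdicCompletionMap (L := L) (IsCMField.complexConj L) hw) J) ⧸
        torusU (galAdicCompletionMap (L := L) (IsCMField.complexConj L) hw) J),
      SMulInvariantMeasure ↥(unitaryGroupOfForm (galAdicCompletionMap (L := L) (IsCMField.complexConj L) hw) J)
          (↥(unitaryGroupOfForm (galAdicCompletionMap (L := L) (IsCMField.complexConj L) hw) J) ⧸
            torusU (galAdicCompletionMap (L := L) (IsCMField.complexConj L) hw) J) μQ ∧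
        IsFiniteMeasureOnCompacts μQ ∧ μQ ≠ 0 := by
  haveI : SecondCountableTopology ↥(unitaryGroupOfForm (galAdicCompletionMap (L := L) (IsCMField.complexConj L) hw) J) :=
    K2E3SupercuspModelFrameAtPlace.secondCountableTopology_unitaryGroupOfForm_adicCompletion L w _ J
  haveI : LocallyCompactSpace ↥(unitaryGroupOfForm (galAdicCompletionMap (L := L) (IsCMField.complexConj L) hw) J) :=
    K2E3SupercuspModelFrameAtPlaceTwo.locallyCompactSpace_unitaryGroupOfForm_adicCompletion L w hw J
  exact K2E3SplitTorusQuotientMeasure.exists_smulInvariantMeasure_quotient_torusU (galAdicCompletionMap (L := L) (IsCMField.complexConj L) hw) J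
    (fun ν hν => by haveI := hν; exact K2E3SupercuspModelFrameAtPlaceTwo.isMulRightInvariant_of_isHaarMeasure_of_eq_over L w hw hJ ν)

end Summit.HodgeConjecture.HodgeConjecture.Cruxes.H413.K2E3SplitTorusQuotientMeasureTwo

end
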